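import Mathlib
import Literature.Analysis.TotalPositivity.PolyaFrequencyDeflation
import HarnessLib

/-!
# The Torontonian, and threshold-detector click probabilities of a Gaussian state

Topic `Literature/LinearAlgebra/Matrix` (a matrix function and a determinant identity), companion of
`Literature/Combinatorics/Enumerative/Hafnian.lean`.  Gaussian boson sampling read out with
THRESHOLD (click / no-click) detectors — the architecture of the USTC *Jiuzhang* experiments — has
output probabilities given by the **Torontonian**: "when sampling Gaussian states with threshold
detectors the output distribution is related to a matrix function that we name the Torontonian"
[cite: QuesadaArrazolaKilloran2018, §I]; "the probability of an outcome `S` is given by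
`p(S) = Tor[O_(S)]/√det(Q)`, where `Tor(A) = Σ_{Z ∈ P([N])} … 1/√det(𝟙 − A_(Z))` is the Torontonian
of a matrix `A ∈ ℂ^{2N × 2N}` … Here `P([N])` is the power set of `[N] := {1, 2, …, N}`"
[cite: QuesadaArrazolaKilloran2018, §III], `O = 𝟙 − Q⁻¹` with `Q` the Husimi covariance matrix of
the (zero-mean) Gaussian state and `A_(Z)` "obtained from `A` by keeping columns and rows
`Z₁, …, Z_{|Z|}` and `Z₁ + N, …, Z_{|Z|} + N`" [cite: QuesadaArrazolaKilloran2018, App. A].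

This file DEFINES the Torontonian and PROVES the click-probability formula from two printed
ingredients, with no quantum-state formalism: (i) a zero-mean Gaussian state with Husimi covariance
`Q` gives no click at all with probability `1/√det Q` (the `S = ∅` case of the formula; the
normalisation `1/(π^ℓ √det(Q))` of the `Q` function [cite: QuesadaArrazolaKilloran2018, §II]), and
the reduced state on a set of modes `R` is Gaussian with covariance "the submatrix of `σ` with rows
and columns `j` and `j + N` for all `j` in the set `R`" [cite: VillalongaEtAl2021, §V]; (ii) the
threshold POVM `{|0⟩⟨0|, 𝟙 − |0⟩⟨0|}` per mode [cite: QuesadaArrazolaKilloran2018, §III] expanded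
with "`Π_{k=1}^{N} (1 − x_k) = Σ_{Z ∈ P([N])} (−1)^{|Z|} Π_{i=1}^{|Z|} x_{Z_i}`"
[cite: QuesadaArrazolaKilloran2018, App. A].  Hence the probability of the click pattern `S` is the
inclusion–exclusion of vacuum marginals `p(S) = Σ_{Z ⊆ S} (−1)^{|Z|} / √det Q_(Z ∪ Sᶜ)` — our
DEFINITION `clickProb` — and the theorem `clickProb_eq_torOn` turns it into `Tor(O_(S))/√det Q` by
Jacobi's complementary-minor identity `det Q_(W) = det Q · det (Q⁻¹)_(Wᶜ)`.

SIGN CONVENTION (the point of doing this in Lean).  We take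
`Tor(A) = Σ_{Z} (−1)^{N − |Z|} / √det(𝟙 − A_(Z))`, `Z` = the KEPT modes, exactly as printed in
[cite: KaposiEtAl2021, §1, defining display of `Tor`]: "`Tor(O) = Σ_{Z ∈ P_N} (−1)^{N/2−|Z|} / √|det(𝟙 − O_Z)|`, where
`P_N` is the power set of `1, 2, …, N/2`" (their `N = 2d` is the matrix size, `d` the number of
modes) with "the elements of `Z` label the optical modes from which matrix `O_Z` is constructed".
The defining paper's display [cite: QuesadaArrazolaKilloran2018, §III] carries the summand sign
`(−1)^{|Z|}`; read with `A_(Z)` = kept rows (its App. A wording) that expression is `(−1)^N` times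
the present one — for one mode and `O = 𝟙 − Q⁻¹` it evaluates to `1 − √det Q ≤ 0` when
`det Q ≥ 1`, whereas `√det Q · p({1}) = √det Q − 1` — and read with `Z` = the deleted rows it
coincides with the present one.  Here nothing is left to reading: `clickProb_eq_torOn` is proved for
the definition `tor` / `torOn` below, and `sum_clickProb` shows the `clickProb S` sum to `1`.

SCOPE / NOT COVERED.  Real matrices (quadrature basis) indexed by an arbitrary finite phase-space
index type `κ` with a mode map `m : κ → ι`, so that `A_(Z)` is the principal block on
`{k | m k ∈ Z}`; the paper's complex `(α, ᾱ)` form is unitarily equivalent mode by mode and changes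
no determinant — not formalised; no density operators, no derivation of (i)/(ii) from a state
formalism, no positivity of `clickProb` (which needs the uncertainty relation, not only `Q`
positive definite), no hardness statement, no algorithm or cost (`O(N³ 2^N)` per Torontonian is a
remark in the source), no hafnian–Torontonian relation (`Tor[O_(S)] = Haf[XO_(S)] + …`, §III of the source).

(pub-qadeq lane context, CLAIMS rows E-11…E-15 / S-4, S-4b — the threshold-detector GBS advantage
claims and their spoofing literature quote Torontonian probabilities.  HONEST FRAMING:
instance-level adjudication of specific advantage claims; no claim about BQP vs BPP or the summit —
this file is linear algebra and says nothing about any experiment.)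

## Contents (all proved; 0 named facts, 0 sorry)

* `modeBlock m A Z` — `A_(Z)`; `det_modeBlock_empty` (`= 1`), `det_modeBlock_univ` (`= det A`).
* `tor m A` — **the Torontonian**, `(−1)^{N} Σ_{Z ⊆ [N]} (−1)^{|Z|}/√det(𝟙 − A)_(Z)`, `N = |ι|`;
  `torOn m A S` — the same sum over `Z ⊆ S` with prefactor `(−1)^{|S|}`, which IS the Torontonian of
  the `2|S| × 2|S|` matrix `A_(S)` (**`tor_modeBlock`**, `tor_eq_torOn_univ`); `torOn_zero`
  (`Tor(0_(S)) = 0` for `S ≠ ∅`: the vacuum never makes every detector click).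
* `vacProb m Q W = 1/√det Q_(W)`, `clickProb m Q S = Σ_{Z ⊆ S} (−1)^{|Z|} vacProb (Z ∪ Sᶜ)`;
  `clickProb_empty` (`p(∅) = 1/√det Q`), **`sum_clickProb`** (`Σ_S p(S) = 1`).
* **`det_mul_det_inv_toSquareBlockProp`** (Jacobi: `det Q · det (Q⁻¹)|_p = det Q|_{¬p}`, from the
  block form `Literature.Analysis.TotalPositivity.det_mul_det_toBlocks₁₁` of
  `PolyaFrequencyDeflation.lean`), `det_modeBlock_union_compl`.
* **`clickProb_eq_torOn`**: for positive definite `Q` and every `S`,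
  `clickProb m Q S = torOn m (𝟙 − Q⁻¹) S / √det Q` — i.e. `p(S) = Tor(O_(S))/√det Q`,
  `O = 𝟙 − Q⁻¹` [cite: QuesadaArrazolaKilloran2018, §III]; `clickProb_univ_eq_tor`.
* `clickPattern m Q S T` — `p(S click, T silent)` with the other modes traced out (a function of
  the block `Q_(S ∪ T)` only); `clickPattern_insert` (law of total probability for one detector),
  `sum_clickPattern`, **`sum_clickProb_union`** (the marginal of `clickProb` on `S ∪ T` IS
  `clickPattern S T` — "marginalized probabilities … with covariance matrix `σ_R`"
  [cite: VillalongaEtAl2021, §V]), `sum_clickProb_mem` (detector `j` clicks with probability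
  `1 − 1/√det Q_({j})`).

## References

* [QuesadaArrazolaKilloran2018] N. Quesada, J. M. Arrazola, N. Killoran, *Gaussian boson sampling
  using threshold detectors*, Phys. Rev. A 98, 062322 (2018) = arXiv:1807.01639, §II (Gaussian
  states, `Q` function), §III (click probabilities and Torontonians), App. A ‘Click probabilities with
  threshold detectors’ (derivation; the notation `F_(Z)`; the product identity).
* [KaposiEtAl2021] Á. Kaposi, Z. Kolarovszki, T. Kozsik, Z. Zimborás, P. Rakyta, *Polynomial speedup
  in Torontonian calculation by a scalable recursive algorithm*, arXiv:2109.04528 (2021), §1 Introduction, the defining display of `Tor`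
  (the sign convention `(−1)^{N/2−|Z|}`, `Z` = kept modes).
* [VillalongaEtAl2021] B. Villalonga, M. Y. Niu, L. Li, H. Neven, J. C. Platt, V. N. Smelyanskiy,
  S. Boixo, *Efficient approximation of experimental Gaussian boson sampling*, arXiv:2109.11525
  (2021), §V (`p(z) = Tor(O_S)/√det σ`; marginal covariance = submatrix).
* [FallatJohnson2011] S. M. Fallat, C. R. Johnson, *Totally Nonnegative Matrices*, Princeton
  University Press (2011), §1.2 eq. (1.3) (Jacobi's identity, principal case
  `det A⁻¹[α] = det A[αᶜ]/det A`).
-/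

namespace Literature.LinearAlgebra.Matrix.Torontonian

open Finset

variable {κ ι : Type*}

/-- `A_(Z)`: the principal sub-block of a phase-space matrix `A` (indexed by `κ`, each index `k`
belonging to the mode `m k`) on the indices of the modes in `Z` — "the matrix obtained from `A` by
keeping columns and rows `Z₁, …, Z_{|Z|}` and `Z₁ + N, …, Z_{|Z|} + N`"
[cite: QuesadaArrazolaKilloran2018, App. A (‘Click probabilities with threshold detectors’)]. -/
def modeBlock (m : κ → ι) (A : Matrix κ κ ℝ) (Z : Finset ι) :
    Matrix {k // m k ∈ Z} {k // m k ∈ Z} ℝ :=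
  A.toSquareBlockProp fun k => m k ∈ Z

/-- Entries of `A_(Z)` are entries of `A` (unfolding; the notation of
[cite: QuesadaArrazolaKilloran2018, App. A (‘Click probabilities with threshold detectors’)]). -/
@[simp] theorem modeBlock_apply (m : κ → ι) (A : Matrix κ κ ℝ) (Z : Finset ι)
    (i j : {k // m k ∈ Z}) : modeBlock m A Z i j = A i j := rfl

/-- `𝟙_(Z) = 𝟙` — used silently in "`det(𝟙 − A_(Z))`" versus "`det[(𝟙 − A)_(Z)]`"
[cite: QuesadaArrazolaKilloran2018, §III]. -/
theorem modeBlock_one [DecidableEq κ] (m : κ → ι) (Z : Finset ι) :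
    modeBlock m (1 : Matrix κ κ ℝ) Z = 1 := by
  ext i j
  simp only [modeBlock_apply, Matrix.one_apply, Subtype.ext_iff]

/-- `(A − B)_(Z) = A_(Z) − B_(Z)`, so `(𝟙 − A)_(Z) = 𝟙 − A_(Z)`
[cite: QuesadaArrazolaKilloran2018, §III]. -/
theorem modeBlock_sub (m : κ → ι) (A B : Matrix κ κ ℝ) (Z : Finset ι) :
    modeBlock m (A - B) Z = modeBlock m A Z - modeBlock m B Z := by
  ext i j; simp

/-- The block on NO mode is the empty matrix, of determinant `1` (the `Z = ∅` term of the
Torontonian sum [cite: QuesadaArrazolaKilloran2018, §III]). -/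
theorem det_modeBlock_empty [Fintype κ] [DecidableEq κ] [DecidableEq ι] (m : κ → ι)
    (A : Matrix κ κ ℝ) : (modeBlock m A ∅).det = 1 := by
  haveI : IsEmpty {k // m k ∈ (∅ : Finset ι)} := ⟨fun k => by simpa using k.2⟩
  exact Matrix.det_isEmpty

/-- The block on ALL modes is `A` itself up to relabelling: `det A_([N]) = det A` (the `Z = [N]`
term of the Torontonian sum [cite: QuesadaArrazolaKilloran2018, §III]). -/
theorem det_modeBlock_univ [Fintype κ] [DecidableEq κ] [Fintype ι] [DecidableEq ι] (m : κ → ι)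
    (A : Matrix κ κ ℝ) : (modeBlock m A univ).det = A.det := by
  rw [show modeBlock m A univ = A.submatrix (Equiv.subtypeUnivEquiv fun k => mem_univ (m k))
      (Equiv.subtypeUnivEquiv fun k => mem_univ (m k)) from rfl, Matrix.det_submatrix_equiv_self]

/-- A powerset alternating sum over `ℝ`: `Σ_{Z ⊆ W} (−1)^{|Z|} = [W = ∅]`. [folklore] -/
private theorem sum_powerset_neg_one_pow_card_real [DecidableEq ι] (W : Finset ι) :
    (∑ Z ∈ W.powerset, (-1 : ℝ) ^ Z.card) = if W = ∅ then 1 else 0 := by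
  have h : (∑ Z ∈ W.powerset, (-1 : ℝ) ^ Z.card)
      = ((∑ Z ∈ W.powerset, (-1 : ℤ) ^ Z.card : ℤ) : ℝ) := by norm_cast
  rw [h, Finset.sum_powerset_neg_one_pow_card]; split_ifs <;> simp

/-! ### 1. The Torontonian -/

/-- **The Torontonian** of a phase-space matrix `A` with `N = |ι|` modes:
`Tor(A) = (−1)^N Σ_{Z ∈ P([N])} (−1)^{|Z|} / √det (𝟙 − A)_(Z) = Σ_Z (−1)^{N−|Z|} / √det(𝟙 − A_(Z))`,
`Z` the KEPT modes — "`Tor(O) = Σ_{Z ∈ P_N} (−1)^{N/2−|Z|} / √|det(𝟙 − O_Z)|`"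
[cite: KaposiEtAl2021, §1, defining display of `Tor`] (their `N/2` = number of modes; the absolute value is immaterial
for the positive definite `𝟙 − O_Z` of the source); cf. [cite: QuesadaArrazolaKilloran2018, §III]
and the SIGN CONVENTION paragraph of the module docstring. -/
noncomputable def tor [Fintype κ] [DecidableEq κ] [Fintype ι] [DecidableEq ι] (m : κ → ι)
    (A : Matrix κ κ ℝ) : ℝ :=
  (-1) ^ Fintype.card ι *
    ∑ Z ∈ (univ : Finset ι).powerset, (-1) ^ Z.card / Real.sqrt (modeBlock m (1 - A) Z).det

/-- `Tor(A_(S))` written without nested subtypes: the modes of `A_(S)` are the elements of `S` and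
its sub-blocks are the `A_(Z)`, `Z ⊆ S`, so
`Tor(A_(S)) = (−1)^{|S|} Σ_{Z ⊆ S} (−1)^{|Z|} / √det (𝟙 − A)_(Z)` (`tor_modeBlock` proves that this
IS `tor` of the matrix `A_(S)`).  This is the quantity `Tor[O_(S)]` of
[cite: QuesadaArrazolaKilloran2018, §III]. -/
noncomputable def torOn [Fintype κ] [DecidableEq κ] [DecidableEq ι] (m : κ → ι)
    (A : Matrix κ κ ℝ) (S : Finset ι) : ℝ :=
  (-1) ^ S.card * ∑ Z ∈ S.powerset, (-1) ^ Z.card / Real.sqrt (modeBlock m (1 - A) Z).det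

/-- `Tor(A) = Tor(A_([N]))`: the full Torontonian is the `S = [N]` case of `torOn`
[cite: KaposiEtAl2021, §1, defining display of `Tor`]. -/
theorem tor_eq_torOn_univ [Fintype κ] [DecidableEq κ] [Fintype ι] [DecidableEq ι] (m : κ → ι)
    (A : Matrix κ κ ℝ) : tor m A = torOn m A univ := by
  simp [tor, torOn, Finset.card_univ]

/-- Sanity value: the Torontonian of the ZERO matrix (vacuum input, `O = 𝟙 − Q⁻¹ = 0` for
`Q = 𝟙`) vanishes as soon as there is a mode — the probability that every threshold detector of `S`
clicks on the vacuum is `0` (an instance of the definition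
[cite: KaposiEtAl2021, §1, defining display of `Tor`]; our computation). -/
theorem torOn_zero [Fintype κ] [DecidableEq κ] [DecidableEq ι] (m : κ → ι) {S : Finset ι}
    (hS : S.Nonempty) : torOn m (0 : Matrix κ κ ℝ) S = 0 := by
  unfold torOn
  have h : ∀ Z ∈ S.powerset,
      ((-1 : ℝ) ^ Z.card / Real.sqrt (modeBlock m (1 - 0) Z).det) = (-1 : ℝ) ^ Z.card := by
    intro Z _
    rw [sub_zero, modeBlock_one, Matrix.det_one, Real.sqrt_one, div_one]
  rw [Finset.sum_congr rfl h, sum_powerset_neg_one_pow_card_real,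
    if_neg (Finset.nonempty_iff_ne_empty.mp hS), mul_zero]

/-! ### 2. Click probabilities of threshold detectors from vacuum marginals -/

/-- Probability that the threshold detectors on the modes `W` ALL stay silent when a zero-mean
Gaussian state with (real-form) Husimi covariance matrix `Q` is measured: the reduced state on `W`
is Gaussian with covariance the sub-block on `W` ("the submatrix of `σ` with rows and columns `j`
and `j + N` for all `j` in the set `R`" [cite: VillalongaEtAl2021, §V]) and a zero-mean Gaussian
state with Husimi covariance `Q` shows no click at all with probability `1/√det(Q)` (the `S = ∅`
case of `p(S) = Tor[O_(S)]/√det(Q)` [cite: QuesadaArrazolaKilloran2018, §III]; the `Q`-function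
normalisation `1/(π^ℓ √det(Q))` of §II there).  A DEFINITION here (no state formalism). -/
noncomputable def vacProb [Fintype κ] [DecidableEq κ] [DecidableEq ι] (m : κ → ι)
    (Q : Matrix κ κ ℝ) (W : Finset ι) : ℝ :=
  1 / Real.sqrt (modeBlock m Q W).det

/-- Probability of the threshold click pattern `S` — clicks on exactly the modes of `S`: the POVM
element is `⊗_{j ∈ S} (𝟙 − |0⟩⟨0|_j) ⊗ ⊗_{j ∉ S} |0⟩⟨0|_j` ("`P̂_0 = |0⟩⟨0|`, `P̂_1 = 𝟙 − P̂_0`"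
[cite: QuesadaArrazolaKilloran2018, §III]); expanding with "`Π_{k=1}^{N} (1 − x_k) =
Σ_{Z ∈ P([N])} (−1)^{|Z|} Π_{i=1}^{|Z|} x_{Z_i}`" [cite: QuesadaArrazolaKilloran2018, App. A] gives
the inclusion–exclusion of vacuum marginals
`p(S) = Σ_{Z ⊆ S} (−1)^{|Z|} · P(no click on Z ∪ Sᶜ)`.  A DEFINITION here. -/
noncomputable def clickProb [Fintype κ] [DecidableEq κ] [Fintype ι] [DecidableEq ι] (m : κ → ι)
    (Q : Matrix κ κ ℝ) (S : Finset ι) : ℝ :=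
  ∑ Z ∈ S.powerset, (-1) ^ Z.card * vacProb m Q (Z ∪ Sᶜ)

/-- Silence on NO mode is certain: `vacProb ∅ = 1` (empty determinant; the normalisation behind
`Σ_S p(S) = 1`) [cite: QuesadaArrazolaKilloran2018, §III]. -/
theorem vacProb_empty [Fintype κ] [DecidableEq κ] [DecidableEq ι] (m : κ → ι)
    (Q : Matrix κ κ ℝ) : vacProb m Q ∅ = 1 := by
  simp [vacProb, det_modeBlock_empty]

/-- Silence on ALL modes: `vacProb [N] = 1/√det Q` [cite: QuesadaArrazolaKilloran2018, §III,
`S = ∅`]. -/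
theorem vacProb_univ [Fintype κ] [DecidableEq κ] [Fintype ι] [DecidableEq ι] (m : κ → ι)
    (Q : Matrix κ κ ℝ) : vacProb m Q univ = 1 / Real.sqrt Q.det := by
  simp [vacProb, det_modeBlock_univ]

/-- No click anywhere: `p(∅) = 1/√det Q` [cite: QuesadaArrazolaKilloran2018, §III, `S = ∅`]. -/
theorem clickProb_empty [Fintype κ] [DecidableEq κ] [Fintype ι] [DecidableEq ι] (m : κ → ι)
    (Q : Matrix κ κ ℝ) : clickProb m Q ∅ = 1 / Real.sqrt Q.det := by
  simp [clickProb, vacProb_univ]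

/-- **The click probabilities sum to one: `Σ_S p(S) = 1`** (pure inclusion–exclusion: substituting
`T = Sᶜ`, the pairs `(T, Z)` with `Z ∩ T = ∅` correspond to the pairs `(W, Z)` with
`Z ⊆ W = T ∪ Z`, and `Σ_{Z ⊆ W} (−1)^{|Z|} = [W = ∅]`, leaving `vacProb ∅ = 1`).  The printed
`p(S)` [cite: QuesadaArrazolaKilloran2018, §III] is a probability distribution over the `2^N` click
patterns; this is its normalisation, proved here from the inclusion–exclusion form alone. -/
theorem sum_clickProb [Fintype κ] [DecidableEq κ] [Fintype ι] [DecidableEq ι] (m : κ → ι)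
    (Q : Matrix κ κ ℝ) : ∑ S, clickProb m Q S = 1 := by
  classical
  -- Step 1: substitute `S ↦ Sᶜ`.
  have h1 : ∑ S, clickProb m Q S
      = ∑ T : Finset ι, ∑ Z ∈ (Tᶜ).powerset, (-1 : ℝ) ^ Z.card * vacProb m Q (Z ∪ T) := by
    refine Fintype.sum_equiv ⟨compl, compl, compl_compl, compl_compl⟩ _ _ fun S => ?_
    simp only [clickProb, Equiv.coe_fn_mk, compl_compl]
  -- Step 2: re-pair `(T, Z) ↦ (W, Z) := (T ∪ Z, Z)`.
  have h2 : (∑ T : Finset ι, ∑ Z ∈ (Tᶜ).powerset, (-1 : ℝ) ^ Z.card * vacProb m Q (Z ∪ T))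
      = ∑ W : Finset ι, ∑ Z ∈ W.powerset, (-1 : ℝ) ^ Z.card * vacProb m Q W := by
    calc (∑ T : Finset ι, ∑ Z ∈ (Tᶜ).powerset, (-1 : ℝ) ^ Z.card * vacProb m Q (Z ∪ T))
        = ∑ x ∈ (univ : Finset (Finset ι)).sigma (fun T => (Tᶜ).powerset),
            (-1 : ℝ) ^ x.2.card * vacProb m Q (x.2 ∪ x.1) := Finset.sum_sigma' _ _ _
      _ = ∑ y ∈ (univ : Finset (Finset ι)).sigma (fun W => W.powerset),
            (-1 : ℝ) ^ y.2.card * vacProb m Q y.1 := by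
          refine Finset.sum_bij' (fun x _ => ⟨x.1 ∪ x.2, x.2⟩) (fun y _ => ⟨y.1 \ y.2, y.2⟩)
            ?_ ?_ ?_ ?_ ?_
          · rintro ⟨T, Z⟩ hx
            simp only [Finset.mem_sigma, Finset.mem_univ, Finset.mem_powerset, true_and] at hx ⊢
            exact Finset.subset_union_right
          · rintro ⟨W, Z⟩ hy
            simp only [Finset.mem_sigma, Finset.mem_univ, Finset.mem_powerset, true_and] at hy ⊢
            intro i hi
            rw [Finset.mem_compl, Finset.mem_sdiff, not_and, not_not]
            exact fun _ => hi
          · rintro ⟨T, Z⟩ hx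
            simp only [Finset.mem_sigma, Finset.mem_univ, Finset.mem_powerset, true_and] at hx
            have hTZ : (T ∪ Z) \ Z = T := by
              ext i
              simp only [Finset.mem_sdiff, Finset.mem_union]
              constructor
              · rintro ⟨h | h, h2⟩
                · exact h
                · exact absurd h h2
              · intro h
                exact ⟨Or.inl h, fun hZ => (Finset.mem_compl.mp (hx hZ)) h⟩
            simp only [hTZ]
          · rintro ⟨W, Z⟩ hy
            simp only [Finset.mem_sigma, Finset.mem_univ, Finset.mem_powerset, true_and] at hy
            have hWZ : (W \ Z) ∪ Z = W := by
              ext i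
              simp only [Finset.mem_sdiff, Finset.mem_union]
              constructor
              · rintro (⟨h, _⟩ | h)
                · exact h
                · exact hy h
              · intro h
                by_cases hZ : i ∈ Z
                · exact Or.inr hZ
                · exact Or.inl ⟨h, hZ⟩
            simp only [hWZ]
          · rintro ⟨T, Z⟩ _
            simp only [Finset.union_comm Z T]
      _ = ∑ W : Finset ι, ∑ Z ∈ W.powerset, (-1 : ℝ) ^ Z.card * vacProb m Q W :=
          (Finset.sum_sigma' univ (fun W : Finset ι => W.powerset)
            (fun W Z => (-1 : ℝ) ^ Z.card * vacProb m Q W)).symm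
  -- Step 3: the inner alternating sum is `[W = ∅]`.
  have h3 : ∀ W : Finset ι, (∑ Z ∈ W.powerset, (-1 : ℝ) ^ Z.card * vacProb m Q W)
      = (if W = ∅ then 1 else 0) * vacProb m Q W := by
    intro W; rw [← Finset.sum_mul, sum_powerset_neg_one_pow_card_real]
  rw [h1, h2]
  simp_rw [h3]
  simp [vacProb_empty]

/-! ### 3. Jacobi's complementary-minor identity -/

/-- **Jacobi's complementary-minor identity** for principal blocks cut out by a predicate: for an
invertible `Q`, `det Q · det((Q⁻¹)|_p) = det(Q|_{¬p})` — "`det A⁻¹[α] = det A[αᶜ] / det A`"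
[cite: FallatJohnson2011, §1.2 eq. (1.3)]. -/
theorem det_mul_det_inv_toSquareBlockProp [Fintype κ] [DecidableEq κ] (Q : Matrix κ κ ℝ)
    (hQ : IsUnit Q.det) (p : κ → Prop) [DecidablePred p] :
    Q.det * (Q⁻¹.toSquareBlockProp p).det = (Q.toSquareBlockProp fun k => ¬p k).det := by
  let e : {a // p a} ⊕ {a // ¬p a} ≃ κ := Equiv.sumCompl p
  have hAB : Q.submatrix e e * Q⁻¹.submatrix e e = 1 := by
    rw [Matrix.submatrix_mul_equiv, Matrix.mul_nonsing_inv _ hQ, Matrix.submatrix_one_equiv]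
  -- Jacobi's identity in block form, as landed in `PolyaFrequencyDeflation.lean`
  have hJ := Literature.Analysis.TotalPositivity.det_mul_det_toBlocks₁₁ _ _ hAB
  rw [Matrix.det_submatrix_equiv_self] at hJ
  have h1 : (Q⁻¹.submatrix e e).toBlocks₁₁ = Q⁻¹.toSquareBlockProp p := by
    ext i j; rfl
  have h2 : (Q.submatrix e e).toBlocks₂₂ = Q.toSquareBlockProp fun k => ¬p k := by
    ext i j; rfl
  rw [h1, h2] at hJ
  exact hJ

/-- Jacobi in the language of mode blocks: `det Q_(Z ∪ Sᶜ) = det Q · det (Q⁻¹)_(S ∖ Z)` (the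
complement of the modes `Z ∪ Sᶜ` is `S ∖ Z`) [cite: FallatJohnson2011, §1.2 eq. (1.3)]. -/
theorem det_modeBlock_union_compl [Fintype κ] [DecidableEq κ] [Fintype ι] [DecidableEq ι]
    (m : κ → ι) (Q : Matrix κ κ ℝ) (hQ : IsUnit Q.det) (S Z : Finset ι) :
    (modeBlock m Q (Z ∪ Sᶜ)).det = Q.det * (modeBlock m Q⁻¹ (S \ Z)).det := by
  simp only [modeBlock]
  rw [det_mul_det_inv_toSquareBlockProp Q hQ]
  refine Matrix.equiv_block_det Q fun k => ?_
  simp only [Finset.mem_union, Finset.mem_compl, Finset.mem_sdiff]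
  tauto

/-! ### 4. Click probabilities are Torontonians -/

/-- `(−1)^{|S ∖ Z|} = (−1)^{|S|} (−1)^{|Z|}` for `Z ⊆ S`. [folklore] -/
private theorem neg_one_pow_card_sdiff [DecidableEq ι] {S Z : Finset ι} (hZ : Z ⊆ S) :
    (-1 : ℝ) ^ (S \ Z).card = (-1) ^ S.card * (-1) ^ Z.card := by
  have hc : (S \ Z).card + Z.card = S.card := Finset.card_sdiff_add_card_eq_card hZ
  have hsq : (-1 : ℝ) ^ Z.card * (-1) ^ Z.card = 1 := by
    rw [← pow_add, ← two_mul]; exact Even.neg_one_pow ⟨Z.card, by ring⟩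
  calc (-1 : ℝ) ^ (S \ Z).card = (-1) ^ (S \ Z).card * ((-1) ^ Z.card * (-1) ^ Z.card) := by
        rw [hsq, mul_one]
    _ = (-1) ^ ((S \ Z).card + Z.card) * (-1) ^ Z.card := by rw [pow_add, mul_assoc]
    _ = (-1) ^ S.card * (-1) ^ Z.card := by rw [hc]

/-- **`p(S) = Tor[O_(S)] / √det(Q)` with `O = 𝟙 − Q⁻¹`** [cite: QuesadaArrazolaKilloran2018, §III]
("`p(z) = Tor(O_S)/√det(σ)`" [cite: VillalongaEtAl2021, §V]), for every positive definite real
Husimi covariance matrix `Q` and every click pattern `S`, with the Torontonian in the sign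
convention of [cite: KaposiEtAl2021, §1, defining display of `Tor`] (`torOn`; = `tor` of the matrix `O_(S)` by
`tor_modeBlock`).  Proof: the definition of `clickProb` (inclusion–exclusion of vacuum marginals),
Jacobi's identity `det Q_(Z ∪ Sᶜ) = det Q · det (Q⁻¹)_(S ∖ Z)` (`det_modeBlock_union_compl`), and
the substitution `Z ↦ S ∖ Z`, under which `(−1)^{|S ∖ Z|} = (−1)^{|S|} (−1)^{|Z|}`. -/
theorem clickProb_eq_torOn [Fintype κ] [DecidableEq κ] [Fintype ι] [DecidableEq ι] (m : κ → ι)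
    {Q : Matrix κ κ ℝ} (hQ : Q.PosDef) (S : Finset ι) :
    clickProb m Q S = torOn m (1 - Q⁻¹) S / Real.sqrt Q.det := by
  have hdet : 0 < Q.det := hQ.det_pos
  have hunit : IsUnit Q.det := hdet.ne'.isUnit
  -- (A) Jacobi on each vacuum marginal, then the substitution `Z ↦ S \ Z`.
  have hA : clickProb m Q S = ∑ Z ∈ S.powerset,
      (-1 : ℝ) ^ (S \ Z).card * (1 / (Real.sqrt Q.det * Real.sqrt (modeBlock m Q⁻¹ Z).det)) := by
    unfold clickProb
    have hJ : ∀ Z ∈ S.powerset, (-1 : ℝ) ^ Z.card * vacProb m Q (Z ∪ Sᶜ)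
        = (-1 : ℝ) ^ Z.card *
            (1 / (Real.sqrt Q.det * Real.sqrt (modeBlock m Q⁻¹ (S \ Z)).det)) := by
      intro Z _
      rw [vacProb, det_modeBlock_union_compl m Q hunit S Z, Real.sqrt_mul hdet.le]
    rw [Finset.sum_congr rfl hJ]
    refine Finset.sum_nbij' (fun Z => S \ Z) (fun Z => S \ Z) ?_ ?_ ?_ ?_ ?_
    · intro Z _; simp
    · intro Z _; simp
    · intro Z hZ; rw [Finset.mem_powerset] at hZ; exact Finset.sdiff_sdiff_eq_self hZ
    · intro Z hZ; rw [Finset.mem_powerset] at hZ; exact Finset.sdiff_sdiff_eq_self hZ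
    · intro Z hZ
      rw [Finset.mem_powerset] at hZ
      simp only [Finset.sdiff_sdiff_eq_self hZ]
  -- (B) the Torontonian side, expanded.
  have hB : torOn m (1 - Q⁻¹) S / Real.sqrt Q.det = ∑ Z ∈ S.powerset,
      (-1 : ℝ) ^ (S \ Z).card * (1 / (Real.sqrt Q.det * Real.sqrt (modeBlock m Q⁻¹ Z).det)) := by
    rw [torOn, sub_sub_cancel, Finset.mul_sum, Finset.sum_div]
    refine Finset.sum_congr rfl fun Z hZ => ?_
    rw [Finset.mem_powerset] at hZ
    rw [neg_one_pow_card_sdiff hZ]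
    ring
  rw [hA, hB]

/-- All detectors click: `p([N]) = Tor(O) / √det Q`, `O = 𝟙 − Q⁻¹` — the `S = [N]` case of
[cite: QuesadaArrazolaKilloran2018, §III]. -/
theorem clickProb_univ_eq_tor [Fintype κ] [DecidableEq κ] [Fintype ι] [DecidableEq ι] (m : κ → ι)
    {Q : Matrix κ κ ℝ} (hQ : Q.PosDef) :
    clickProb m Q univ = tor m (1 - Q⁻¹) / Real.sqrt Q.det := by
  rw [clickProb_eq_torOn m hQ, tor_eq_torOn_univ]

/-! ### 5. `torOn m A S` is the Torontonian of the matrix `A_(S)` -/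

/-- The mode map of the sub-block `A_(S)`: its indices are the indices of `A` on the modes of `S`,
its modes are the elements of `S` (plumbing for `tor_modeBlock`). [folklore] -/
def subMode (m : κ → ι) (S : Finset ι) (k : {k // m k ∈ S}) : {i // i ∈ S} := ⟨m k, k.2⟩

/-- `𝟙 − A_(S) = (𝟙 − A)_(S)` [cite: QuesadaArrazolaKilloran2018, §III]. -/
theorem one_sub_modeBlock [DecidableEq κ] (m : κ → ι) (A : Matrix κ κ ℝ) (S : Finset ι) :
    1 - modeBlock m A S = modeBlock m (1 - A) S := by
  rw [modeBlock_sub, modeBlock_one]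

/-- **`Tor(A_(S)) = torOn m A S`**: the Torontonian (sum over the subsets of the modes `S` of the
`2|S| × 2|S|` matrix `A_(S)`) is the sum over the subsets `Z ⊆ S` of the blocks `A_(Z)` — the
form in which `clickProb_eq_torOn` states `p(S) = Tor[O_(S)]/√det(Q)`
[cite: QuesadaArrazolaKilloran2018, §III]; relabelling only. -/
theorem tor_modeBlock [Fintype κ] [DecidableEq κ] [DecidableEq ι] (m : κ → ι)
    (A : Matrix κ κ ℝ) (S : Finset ι) :
    tor (subMode m S) (modeBlock m A S) = torOn m A S := by
  unfold tor torOn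
  rw [Fintype.card_coe]
  congr 1
  refine Finset.sum_nbij' (fun Z' => Z'.map (Function.Embedding.subtype _))
    (fun Z => Z.subtype (· ∈ S)) ?_ ?_ ?_ ?_ ?_
  · intro Z' _
    rw [Finset.mem_powerset]
    exact fun i hi => Finset.property_of_mem_map_subtype Z' hi
  · intro Z _
    rw [Finset.mem_powerset]
    exact Finset.subset_univ _
  · intro Z' _
    ext a
    simp only [Finset.mem_subtype, Finset.mem_map, Function.Embedding.coe_subtype]
    constructor
    · rintro ⟨b, hb, h⟩
      rwa [← Subtype.ext h]
    · intro ha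
      exact ⟨a, ha, rfl⟩
  · intro Z hZ
    rw [Finset.mem_powerset] at hZ
    rw [Finset.subtype_map]
    exact Finset.filter_true_of_mem fun i hi => hZ hi
  · intro Z' _
    rw [Finset.card_map, one_sub_modeBlock]
    congr 2
    -- the two blocks are the same matrix up to relabelling
    have hS : ∀ k : {k // m k ∈ Z'.map (Function.Embedding.subtype (· ∈ S))}, m k.1 ∈ S :=
      fun k => Finset.property_of_mem_map_subtype Z' k.2
    have hZ : ∀ k : {k // m k ∈ Z'.map (Function.Embedding.subtype (· ∈ S))},
        subMode m S ⟨k.1, hS k⟩ ∈ Z' :=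
      fun k => (Finset.mem_map' (Function.Embedding.subtype (· ∈ S))).mp k.2
    let e : {k' : {k // m k ∈ S} // subMode m S k' ∈ Z'} ≃
        {k // m k ∈ Z'.map (Function.Embedding.subtype (· ∈ S))} :=
      { toFun := fun k' => ⟨k'.1.1, Finset.mem_map.mpr ⟨subMode m S k'.1, k'.2, rfl⟩⟩
        invFun := fun k => ⟨⟨k.1, hS k⟩, hZ k⟩
        left_inv := fun k' => Subtype.ext (Subtype.ext rfl)
        right_inv := fun k => Subtype.ext rfl }
    rw [show modeBlock m (1 - A) (Z'.map (Function.Embedding.subtype (· ∈ S)))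
        = (modeBlock (subMode m S) (modeBlock m (1 - A) S) Z').submatrix e.symm e.symm from by
          ext k l; rfl,
      Matrix.det_submatrix_equiv_self]


/-! ### 6. Marginals: click patterns with unobserved modes -/

/-- Probability that the threshold detectors on the modes `S` ALL click and those on `T` ALL stay
silent, the remaining modes being ignored (traced out): the same inclusion–exclusion as `clickProb`,
`p(S click, T silent) = Σ_{Z ⊆ S} (−1)^{|Z|} · P(no click on Z ∪ T)`, which involves only the block
`Q_(S ∪ T)` — "Computing marginalized probabilities is then also done with Eq. (…), starting with
covariance matrix `σ_R`" [cite: VillalongaEtAl2021, §V].  A DEFINITION; `sum_clickProb_union`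
proves that it IS the marginal of `clickProb`. -/
noncomputable def clickPattern [Fintype κ] [DecidableEq κ] [DecidableEq ι] (m : κ → ι)
    (Q : Matrix κ κ ℝ) (S T : Finset ι) : ℝ :=
  ∑ Z ∈ S.powerset, (-1) ^ Z.card * vacProb m Q (Z ∪ T)

/-- The full click pattern `S` is the case `T = Sᶜ` (nothing traced out)
[cite: QuesadaArrazolaKilloran2018, §III]. -/
theorem clickProb_eq_clickPattern [Fintype κ] [DecidableEq κ] [Fintype ι] [DecidableEq ι]
    (m : κ → ι) (Q : Matrix κ κ ℝ) (S : Finset ι) :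
    clickProb m Q S = clickPattern m Q S Sᶜ := rfl

/-- Nothing required: `p(∅ click, T silent) = P(no click on T) = 1/√det Q_(T)`
[cite: VillalongaEtAl2021, §V]. -/
theorem clickPattern_empty_left [Fintype κ] [DecidableEq κ] [DecidableEq ι] (m : κ → ι)
    (Q : Matrix κ κ ℝ) (T : Finset ι) : clickPattern m Q ∅ T = vacProb m Q T := by
  simp [clickPattern]

/-- **Law of total probability for one detector**: for a mode `j` outside `S` and `T`,
`p(S click, T silent) = p(S ∪ {j} click, T silent) + p(S click, T ∪ {j} silent)`
(marginal consistency of the threshold statistics [cite: VillalongaEtAl2021, §V]; proof: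
split the subsets of `S ∪ {j}` by whether they contain `j`). -/
theorem clickPattern_insert [Fintype κ] [DecidableEq κ] [DecidableEq ι] (m : κ → ι)
    (Q : Matrix κ κ ℝ) {S T : Finset ι} {j : ι} (hj : j ∉ S) :
    clickPattern m Q (insert j S) T + clickPattern m Q S (insert j T) = clickPattern m Q S T := by
  unfold clickPattern
  rw [Finset.sum_powerset_insert hj]
  have h : ∀ Z ∈ S.powerset, (-1 : ℝ) ^ (insert j Z).card * vacProb m Q (insert j Z ∪ T)
      = -((-1 : ℝ) ^ Z.card * vacProb m Q (Z ∪ insert j T)) := by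
    intro Z hZ
    rw [Finset.mem_powerset] at hZ
    have hjZ : j ∉ Z := fun h => hj (hZ h)
    rw [Finset.card_insert_of_notMem hjZ, pow_succ, Finset.insert_union, ← Finset.union_insert]
    ring
  rw [Finset.sum_congr rfl h, Finset.sum_neg_distrib]
  ring

/-- **Marginalisation**: for disjoint `S`, `T` and a set `R` of further modes, summing the
patterns over which of the modes of `R` click gives back the pattern on `S`, `T`:
`Σ_{U ⊆ R} p((S ∪ U) click, (T ∪ (R ∖ U)) silent) = p(S click, T silent)`
[cite: VillalongaEtAl2021, §V] (induction on `R` with `clickPattern_insert`). -/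
theorem sum_clickPattern [Fintype κ] [DecidableEq κ] [DecidableEq ι] (m : κ → ι)
    (Q : Matrix κ κ ℝ) (R : Finset ι) :
    ∀ S T : Finset ι, Disjoint R S → Disjoint R T →
      ∑ U ∈ R.powerset, clickPattern m Q (S ∪ U) (T ∪ (R \ U)) = clickPattern m Q S T := by
  classical
  induction R using Finset.induction_on with
  | empty =>
      intro S T _ _
      simp
  | @insert j R hjR ih =>
      intro S T hS hT
      rw [Finset.disjoint_insert_left] at hS hT
      rw [Finset.sum_powerset_insert hjR]
      have h1 : ∀ U ∈ R.powerset, clickPattern m Q (S ∪ U) (T ∪ (insert j R \ U))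
          = clickPattern m Q (S ∪ U) (insert j T ∪ (R \ U)) := by
        intro U hU
        rw [Finset.mem_powerset] at hU
        have hjU : j ∉ U := fun h => hjR (hU h)
        rw [Finset.insert_sdiff_of_notMem R hjU, Finset.union_insert, Finset.insert_union]
      have h2 : ∀ U ∈ R.powerset, clickPattern m Q (S ∪ insert j U) (T ∪ (insert j R \ insert j U))
          = clickPattern m Q (insert j S ∪ U) (T ∪ (R \ U)) := by
        intro U hU
        rw [Finset.mem_powerset] at hU
        have hsd : insert j R \ insert j U = R \ U := by
          ext i
          simp only [Finset.mem_sdiff, Finset.mem_insert]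
          constructor
          · rintro ⟨h | h, hn⟩
            · exact absurd (Or.inl h) hn
            · exact ⟨h, fun hi => hn (Or.inr hi)⟩
          · rintro ⟨h, hn⟩
            refine ⟨Or.inr h, ?_⟩
            rintro (hi | hi)
            · exact hjR (hi ▸ h)
            · exact hn hi
        rw [hsd, Finset.union_insert, Finset.insert_union]
      rw [Finset.sum_congr rfl h1, Finset.sum_congr rfl h2,
        ih S (insert j T) hS.2 (Finset.disjoint_insert_right.mpr ⟨hjR, hT.2⟩),
        ih (insert j S) T (Finset.disjoint_insert_right.mpr ⟨hjR, hS.2⟩) hT.2,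
        add_comm, clickPattern_insert m Q hS.1]

/-- **Marginals of the click distribution are click patterns**: for disjoint `S`, `T`, summing the
full click probabilities `p(S')` over all patterns `S' = S ∪ U` that click on `S` and stay silent on
`T` (`U` ranging over the subsets of the remaining modes) gives `p(S click, T silent)` — the
marginal on the modes `S ∪ T`, computed from the block `Q_(S ∪ T)` alone
[cite: VillalongaEtAl2021, §V]. -/
theorem sum_clickProb_union [Fintype κ] [DecidableEq κ] [Fintype ι] [DecidableEq ι] (m : κ → ι)
    (Q : Matrix κ κ ℝ) {S T : Finset ι} (hST : Disjoint S T) :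
    ∑ U ∈ ((S ∪ T)ᶜ).powerset, clickProb m Q (S ∪ U) = clickPattern m Q S T := by
  have hRS : Disjoint (S ∪ T)ᶜ S := by
    rw [Finset.disjoint_left]; intro i hi his
    exact (Finset.mem_compl.mp hi) (Finset.mem_union_left T his)
  have hRT : Disjoint (S ∪ T)ᶜ T := by
    rw [Finset.disjoint_left]; intro i hi hit
    exact (Finset.mem_compl.mp hi) (Finset.mem_union_right S hit)
  rw [← sum_clickPattern m Q (S ∪ T)ᶜ S T hRS hRT]
  refine Finset.sum_congr rfl fun U hU => ?_
  rw [Finset.mem_powerset] at hU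
  rw [clickProb_eq_clickPattern]
  congr 1
  -- (S ∪ U)ᶜ = T ∪ ((S ∪ T)ᶜ \ U)
  ext i
  simp only [Finset.mem_compl, Finset.mem_union, Finset.mem_sdiff, not_or]
  constructor
  · rintro ⟨hiS, hiU⟩
    by_cases hiT : i ∈ T
    · exact Or.inl hiT
    · exact Or.inr ⟨⟨hiS, hiT⟩, hiU⟩
  · rintro (hiT | ⟨⟨hiS, hiT⟩, hiU⟩)
    · exact ⟨fun hiS => Finset.disjoint_left.mp hST hiS hiT, fun hiU => (Finset.mem_compl.mp (hU hiU)) (Finset.mem_union_right S hiT)⟩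
    · exact ⟨hiS, hiU⟩

/-- In particular the ONE-MODE marginal: detector `j` clicks with probability
`1 − 1/√det Q_({j})` [cite: VillalongaEtAl2021, §V] — the one-mode check of the module docstring. -/
theorem sum_clickProb_mem [Fintype κ] [DecidableEq κ] [Fintype ι] [DecidableEq ι] (m : κ → ι)
    (Q : Matrix κ κ ℝ) (j : ι) :
    ∑ U ∈ ({j}ᶜ : Finset ι).powerset, clickProb m Q (insert j U) = 1 - vacProb m Q {j} := by
  have h := sum_clickProb_union m Q (S := {j}) (T := ∅) (Finset.disjoint_empty_right _)
  rw [Finset.union_empty] at h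
  simp only [Finset.insert_eq]
  rw [h, clickPattern, ← Finset.insert_empty, Finset.sum_powerset_insert (Finset.notMem_empty j),
    Finset.powerset_empty, Finset.sum_singleton, Finset.sum_singleton,
    Finset.card_insert_of_notMem (Finset.notMem_empty j), Finset.card_empty, pow_zero,
    Finset.empty_union, vacProb_empty, Finset.union_empty, Finset.insert_empty]
  ring

end Literature.LinearAlgebra.Matrix.Torontonian
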